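import Mathlib.Analysis.Normed.Module.FiniteDimension
import Mathlib.Analysis.InnerProductSpace.PiL2
import Mathlib.Analysis.SpecificLimits.Basic
import Mathlib.Topology.MetricSpace.Sequences
import Literature.MathematicalPhysics.StatisticalMechanics.BarlowStacking
import Literature.Probability.Process.RootedHardCoreConfig

/-!
# Compactness: windows matched at every scale are matched exactly

Stub `stub_exactWindowOfAllScales` of line `Sketch` of the crux
`Summit.AtomisticToContinuum.Crystallization.Theses.PricedLinkCensus.StackingHinge`
(item `stmt-AtomisticToContinuum-14993`).

## Statement

Let `0 < a`, `0 < h`, and let `S ⊆ ℝ³` be locally finite (every closed ball about `0` meets `S`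
in a finite set). If for every `n : ℕ` some linear isometry equivalence `A_n` two-way
`1/(n+1)`-matches the radius-`3` window of `S` with the radius-`3` window of the rotated relaxed
hcp net `A_n '' hcpStacking a h`, then some linear isometry equivalence `A` matches the two
windows EXACTLY: every `y ∈ S` with `‖y‖ ≤ 3` is `A z` for some site `z`, and `A z ∈ S` for every
site `z` with `‖z‖ ≤ 3`.

## Proof

COMPACTNESS OF THE ORTHOGONAL GROUP (`exists_subseq_tendsto_linearIsometryEquiv`): the maps
`A_n`, viewed in the proper space `ℝ³ →L[ℝ] ℝ³` (finite-dimensional), have operator norm `≤ 1`,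
so a subsequence `A_{φ k}` converges to some `T`; the pointwise limit preserves norms, hence is a
linear isometry, hence (equal finite dimensions) a linear isometry equivalence `B`.

PASSING TO THE LIMIT: the net `hcpStacking a h` is `min a h`-separated
(`le_dist_of_mem_barlowStacking`), so it meets the closed ball of radius `4` in a finite set, and
so does `S` by hypothesis. Fix `y ∈ S`, `‖y‖ ≤ 3`, and suppose `y ≠ B z` for every site `z`. For
each of the finitely many sites `z` with `‖z‖ ≤ 4`, `dist y (A_{φ k} z) → dist y (B z) > 0` while
`1/(φ k + 1) → 0`, so for `k` large `1/(φ k + 1) < dist y (A_{φ k} z)` simultaneously for all such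
`z`; but the matching at scale `φ k` provides a site `z_k` with
`dist y (A_{φ k} z_k) ≤ 1/(φ k + 1) ≤ 1`, whence `‖z_k‖ = ‖A_{φ k} z_k‖ ≤ 4` — contradiction. The
second clause is symmetric, with the finite set `S ∩ B̄(0, 4)` in place of the sites of norm
`≤ 4`.
-/

noncomputable section

namespace Summit.AtomisticToContinuum.Crystallization.Theorems.PricedHcpWindowsExactWindow

open Filter Topology Metric Set
open Literature.MathematicalPhysics.StatisticalMechanics

/-! ## Compactness of the orthogonal group -/

/-- **Sequential compactness of the linear isometry group of a finite-dimensional real normed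
space**: every sequence of linear isometry equivalences has a pointwise convergent subsequence
whose limit is again a linear isometry equivalence (bounded sequence in the proper space
`F →L[ℝ] F`; the limit preserves norms; a linear isometry of a finite-dimensional space into
itself is onto). [folklore] -/
theorem exists_subseq_tendsto_linearIsometryEquiv {F : Type*} [NormedAddCommGroup F]
    [NormedSpace ℝ F] [FiniteDimensional ℝ F] (A : ℕ → F ≃ₗᵢ[ℝ] F) :
    ∃ (B : F ≃ₗᵢ[ℝ] F) (φ : ℕ → ℕ), StrictMono φ ∧
      ∀ x, Tendsto (fun k => A (φ k) x) atTop (𝓝 (B x)) := by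
  set u : ℕ → (F →L[ℝ] F) := fun n => (A n).toLinearIsometry.toContinuousLinearMap with hu_def
  have hu : ∀ n, u n ∈ closedBall (0 : F →L[ℝ] F) 1 := fun n =>
    mem_closedBall_zero_iff.2 (LinearIsometry.norm_toContinuousLinearMap_le _)
  obtain ⟨T, -, φ, hφ, hlim⟩ := tendsto_subseq_of_bounded isBounded_closedBall hu
  have hpt : ∀ x, Tendsto (fun k => A (φ k) x) atTop (𝓝 (T x)) := by
    intro x
    have hx : Tendsto (fun k => (u (φ k)) x) atTop (𝓝 (T x)) :=
      ((ContinuousLinearMap.apply ℝ F x).continuous.tendsto _).comp hlim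
    simpa [hu_def] using hx
  have hnorm : ∀ x, ‖T x‖ = ‖x‖ := fun x =>
    tendsto_nhds_unique (hpt x).norm (by simp)
  let L : F →ₗᵢ[ℝ] F := ⟨T.toLinearMap, hnorm⟩
  exact ⟨L.toLinearIsometryEquiv rfl, φ, hφ, fun x => by simpa [L] using hpt x⟩

/-! ## Elementary tools -/

/-- `‖a‖ ≤ dist b a + ‖b‖`. [folklore] -/
theorem norm_le_dist_add_norm {F : Type*} [SeminormedAddCommGroup F] (a b : F) :
    ‖a‖ ≤ dist b a + ‖b‖ := by
  rw [dist_comm]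
  simpa only [dist_zero_right] using dist_triangle a b 0

/-- `1/(n+1) ≤ 1` for `n : ℕ`. [folklore] -/
theorem one_div_nat_add_one_le_one (n : ℕ) : 1 / ((n : ℝ) + 1) ≤ 1 := by
  rw [div_le_one (Nat.cast_add_one_pos n)]
  simp

/-- The relaxed hcp net with `0 < a`, `0 < h` meets every closed ball in a finite set (it is
`min a h`-separated). [folklore] -/
theorem finite_closedBall_inter_hcpStacking {a h : ℝ} (ha : 0 < a) (hh : 0 < h) (r : ℝ) :
    (closedBall (0 : EuclideanSpace ℝ (Fin 3)) r ∩ hcpStacking a h).Finite :=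
  Literature.Probability.Process.LocalConfig.finite_inter_of_separated (lt_min ha hh)
    (fun _ hx _ hy hxy => le_dist_of_mem_barlowStacking a h alternatingHagg ha.le hh.le hx hy hxy)
    (isCompact_closedBall 0 r)

/-- **Limit step** (finitely many candidates, tolerances `ε_k → 0`): if `Q` meets the closed
ball of radius `4` in a finite set, the quantities `D k q` converge, as `k → ∞`, to positive limits
for `q ∈ Q`, and `D k q ≤ 1` forces `‖q‖ ≤ 4` for `q ∈ Q`, then for some `k` no `q ∈ Q` has
`D k q ≤ ε_k` (for `k` large, `ε_k < D k q` simultaneously for the finitely many candidates).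
[folklore] -/
theorem exists_forall_not_le {F : Type*} [SeminormedAddCommGroup F] {Q : Set F}
    (hQ : (closedBall (0 : F) 4 ∩ Q).Finite) {D : ℕ → F → ℝ} {ℓ : F → ℝ}
    (hD : ∀ q ∈ Q, Tendsto (fun k => D k q) atTop (𝓝 (ℓ q))) (hℓ : ∀ q ∈ Q, 0 < ℓ q)
    (hnorm : ∀ k, ∀ q ∈ Q, D k q ≤ 1 → ‖q‖ ≤ 4) {ε : ℕ → ℝ} (hε : Tendsto ε atTop (𝓝 0))
    (hε1 : ∀ k, ε k ≤ 1) : ∃ k : ℕ, ∀ q ∈ Q, ¬ D k q ≤ ε k := by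
  have hev : ∀ᶠ k in atTop, ∀ q ∈ closedBall (0 : F) 4 ∩ Q, ε k < D k q :=
    (eventually_all_finite hQ).2 fun q hq => hε.eventually_lt (hD q hq.2) (hℓ q hq.2)
  obtain ⟨k, hk⟩ := hev.exists
  refine ⟨k, fun q hq hle => ?_⟩
  have hq4 : q ∈ closedBall (0 : F) 4 ∩ Q :=
    ⟨mem_closedBall_zero_iff.2 (hnorm k q hq (hle.trans (hε1 k))), hq⟩
  exact absurd hle (not_le.2 (hk q hq4))

/-! ## The stub -/

/-- **Compactness: matched at all scales ⇒ exact window.** For `0 < a`, `0 < h` and a locally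
finite `S ⊆ ℝ³`, if for every `n` some linear isometry equivalence two-way `1/(n+1)`-matches the
radius-`3` window of `S` with that of the rotated relaxed hcp net, then some linear isometry
equivalence matches them exactly (subsequence of the rotations converging in the compact
orthogonal group; matched partners range over finite sets). [folklore] -/
theorem stub_exactWindowOfAllScales : ∀ a h : ℝ, 0 < a → 0 < h → ∀ S : Set (EuclideanSpace ℝ (Fin 3)), (∀ r : ℝ, (Metric.closedBall (0 : EuclideanSpace ℝ (Fin 3)) r ∩ S).Finite) → (∀ n : ℕ, ∃ A : EuclideanSpace ℝ (Fin 3) ≃ₗᵢ[ℝ] EuclideanSpace ℝ (Fin 3), ((∀ y ∈ S, ‖y‖ ≤ 3 → ∃ z ∈ Literature.MathematicalPhysics.StatisticalMechanics.hcpStacking a h, dist y (A z) ≤ 1 / ((n : ℝ) + 1)) ∧ (∀ z ∈ Literature.MathematicalPhysics.StatisticalMechanics.hcpStacking a h, ‖z‖ ≤ 3 → ∃ y ∈ S, dist y (A z) ≤ 1 / ((n : ℝ) + 1)))) → ∃ A : EuclideanSpace ℝ (Fin 3) ≃ₗᵢ[ℝ] EuclideanSpace ℝ (Fin 3), ((∀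 y ∈ S, ‖y‖ ≤ 3 → ∃ z ∈ Literature.MathematicalPhysics.StatisticalMechanics.hcpStacking a h, y = A z) ∧ (∀ z ∈ Literature.MathematicalPhysics.StatisticalMechanics.hcpStacking a h, ‖z‖ ≤ 3 → A z ∈ S)) := by
  intro a h ha hh S hS hmatch
  choose A hA₁ hA₂ using hmatch
  obtain ⟨B, φ, hφ, hlim⟩ := exists_subseq_tendsto_linearIsometryEquiv A
  have hε : Tendsto (fun k => 1 / ((φ k : ℝ) + 1)) atTop (𝓝 0) :=
    tendsto_one_div_add_atTop_nhds_zero_nat.comp hφ.tendsto_atTop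
  have hε1 : ∀ k, 1 / ((φ k : ℝ) + 1) ≤ 1 := fun k => one_div_nat_add_one_le_one _
  refine ⟨B, fun y hy hy3 => ?_, fun z hz hz3 => ?_⟩
  · -- a point of the window of `S` is the image of a site: candidates = sites of norm `≤ 4`
    by_contra hne
    push Not at hne
    have hnorm : ∀ k, ∀ q ∈ hcpStacking a h, dist y (A (φ k) q) ≤ 1 → ‖q‖ ≤ 4 :=
      fun k q _ hle =>
        calc ‖q‖ = ‖A (φ k) q‖ := ((A (φ k)).norm_map q).symm
          _ ≤ dist y (A (φ k) q) + ‖y‖ := norm_le_dist_add_norm _ _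
          _ ≤ 1 + 3 := add_le_add hle hy3
          _ = 4 := by norm_num
    obtain ⟨k, hk⟩ := exists_forall_not_le (finite_closedBall_inter_hcpStacking ha hh 4)
      (D := fun k q => dist y (A (φ k) q)) (fun q _ => tendsto_const_nhds.dist (hlim q))
      (fun q hq => dist_pos.2 (hne q hq)) hnorm hε hε1
    obtain ⟨z, hz, hdist⟩ := hA₁ (φ k) y hy hy3
    exact hk z hz hdist
  · -- the image of a site of the window is a point of `S`: candidates = points of norm `≤ 4`
    by_contra hBz
    have hne : ∀ q ∈ S, 0 < dist q (B z) := fun q hq =>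
      dist_pos.2 fun hqz => hBz (hqz ▸ hq)
    have hnorm : ∀ k, ∀ q ∈ S, dist q (A (φ k) z) ≤ 1 → ‖q‖ ≤ 4 := fun k q _ hle =>
      calc ‖q‖ ≤ dist q (A (φ k) z) + ‖A (φ k) z‖ := by
            simpa only [dist_zero_right] using dist_triangle q (A (φ k) z) 0
        _ = dist q (A (φ k) z) + ‖z‖ := by rw [(A (φ k)).norm_map z]
        _ ≤ 1 + 3 := add_le_add hle hz3
        _ = 4 := by norm_num
    obtain ⟨k, hk⟩ := exists_forall_not_le (hS 4) (D := fun k q => dist q (A (φ k) z))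
      (fun q _ => tendsto_const_nhds.dist (hlim z)) hne hnorm hε hε1
    obtain ⟨y, hy, hdist⟩ := hA₂ (φ k) z hz hz3
    exact hk y hy hdist

end Summit.AtomisticToContinuum.Crystallization.Theorems.PricedHcpWindowsExactWindow
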